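import Summits.ResolutionOfSingularities.ResolutionOfSingularities.Theorems.WeightedInvariantJOpenPresentationIsolatedPoint
import Summits.ResolutionOfSingularities.ResolutionOfSingularities.Theorems.WeightedInvariantJOpenPresentationTieStratum
import HarnessLib

/-!
# (open″)≤3 for the pair of record `(ι₃ᵗ, J₃ᵗ)` — THE TIE POINT BODY (P₀₁) `JOpenLE3.PointBodyLE3 p 0 1`, from the presentation
# of `J₃ᵗ` at `ε = 0` point-centre positions and the stratum iff at a tie point (door `HypersurfaceCentreConstruction`,
# stmt-ResolutionOfSingularities-19897; P3 rung clause h8 `JOpenPresentationForallSingLE 3 p Iota3.iotaFlatT Iota3.jFlatT`; input `hP01`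
# of res-D-brk-1's regime assembly `JOpenLE3.jOpenPresentationForallSingLE_three_of`; DEAL (o52-Bτ) of res-L1-w43-plan-1
# 2026-08-27T18:54:37Z, hand res-D-pv-038)

Topic: `Summits/ResolutionOfSingularities/ResolutionOfSingularities/Theorems`. Helper for the door item
`HypersurfaceCentreConstruction` (stmt-ResolutionOfSingularities-19897, route `WeightedInvariant`), line `local-engine` (L W4.3),
def-free.  At a model position `(A, 𝔪, F)` (`k₀` perfect of characteristic `p`, `A` of finite type, `A_𝔪` regular of dimension `3`,
`0 ≠ F/1 ∈ 𝔪² A_𝔪`) whose top `ι₀ = (ν ; ε ; τ)`-stratum is the closed point with `(ε, τ) = (0, 1)` — a TIE point — the literal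
∃-body `JOpenLE3.JOpenBodyLE3 iotaFlatT jFlatT A 𝔪 F` holds AS SOON AS `J₃ᵗ(A_𝔪, F/1)` is presented by a positively weighted minimal
system of generators of `𝔪 A_𝔪`: hypothesis (σ-pres)₃ = res-L1-w43-plan-1's `SigmaPresentationLE3Body p` (SPEC (Δ12) rev 2
`JSigmaCanon_sketch.lean` aceffaa8e08fb006 l.147, the text of record = the `hσ` of `JOpenLE3.pointBodyLE3_zero_zero_of`, p560019,
VERBATIM).  There `jFlatT = jSigmaPt` is the choice-free sup over the σ-attaining primitive two-flags, so (σ-pres)₃ = σ-ATTAINMENT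
(o70-a) + (J-can) (o70-b) + the r.s.p. completion (o70-x) through the registrar's PROVED glue `sigmaPresentationLE3Body_of_bodies` —
candidate obligations of OUR line, NAMED in the signature, never discharged by assumption elsewhere.

THE ι-SIDE is res-L1-w43-stub-3's `CrossingPoint.exists_stratumIff_tie` (…JOpenPresentationTieStratum, p561178; RULING h8 POINT
BODIES 2026-08-27T19:09:30Z (b): «038 imports them by name; no duplicate ι-work»): on a basic open `D(h₁) ∋ 𝔪`, at the primes of
local dimension `≤ 3`, `𝔪 ≤ 𝔮 ↔ (F ∈ 𝔪_{A_𝔮}² ∧ ι₃ᵗ(A_𝔮) F = ι₃ᵗ(A_𝔪) F)` (tie primes over the `(ν ; ε)`-curve are finitely many,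
res-D-brk-1's `TieFinite.finite_tiePrimes_over`, p559175).

THE ASSEMBLY is the point engine `TiePoint.jOpenBodyLE3_of_pointStratumIff`: the stratum iff at the point in `ι₃ᵗ`-form + a
presentation `jFlatT (A_𝔪) (F/1) m = weightedMonomialIdeal xy W m` by a positively weighted system spanning `𝔪 A_𝔪` with independent
differentials ⇒ the body, with `U` = numerators of `xy` (unit scaling `GenericEquimultiplicity.weightedMonomialIdeal_unit_mul`, the
`U`-bridge `StratumIff.exists_forall_le_iff_comap_le`, heights `GenericEquimultiplicity.eq_of_le_of_ringKrullDim_le`: the presentation is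
demanded only at `𝔮 = 𝔪`).  It serves every point-centre position of the pair of record (ISOLATED / TIE / CROSSING) given its ι-side.

* §1 `TiePoint.jOpenBodyLE3_of_pointStratumIff` — the point engine for `(iotaFlatT, jFlatT)`.
* §2 **`JOpenLE3.pointBodyLE3_zero_one_of (hσ : (σ-pres)₃) : PointBodyLE3 p 0 1`**.

[OURS · L1 W4.3 · (o52-Bτ)]  Replaces the role of NO printed item; NOT a statement of the manuscript
[claim: Hironaka2017, status: under-review]. AI work, weaker than expert review.  Pure commutative algebra; no named facts; the one
hypothesis (σ-pres)₃ is a CANDIDATE obligation of OUR line, spelled out in the theorem's signature.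

## References

* V. Cossart, O. Piltant, *Resolution of singularities of threefolds in positive characteristic I*, J. Algebra 320 (2008),
  Prop. 4.2 (proof) (generic behaviour of the order along a regular prime). [CossartPiltant2008]
* D. Abramovich, M. H. Quek, B. Schober, *Torus actions, weighted blow-ups, and desingularization of plane curves*, arXiv:2507.01232
  (2026), Thm 1.3, Thm 3.5 (the lex-maximal weighted centre germ behind the tie datum). [AbramovichQuekSchober2025]
* H. Matsumura, *Commutative Ring Theory* (1987), Thm. 13.5 (heights), Thm. 14.2 (regular parameters). [Matsumura1987]
* res-L1-w43-plan-1, IOTA3-DESIGN v1.3 §8.4 and DEAL (o52) SPLIT (OURS, AI planning); res-D-brk-1 `…TieFinitePrimesOver` (p559175),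
  `…JOpenPresentationLE3Defs` (p553420); res-L1-w43-stub-3 `…JOpenPresentationTieStratum` (p561178) (OURS, AI work).
-/

noncomputable section

open IsLocalRing Literature.AlgebraicGeometry.Resolution
open Summit.ResolutionOfSingularities.ResolutionOfSingularities.Cruxes.HypersurfaceCentreConstruction.LocalEngine
open Summit.ResolutionOfSingularities.ResolutionOfSingularities.Cruxes.HypersurfaceCentreConstruction.LocalEngine.Iota3

set_option linter.dupNamespace false -- mandated namespace of this single-conjunct summit

namespace Summit.ResolutionOfSingularities.ResolutionOfSingularities.Theorems

namespace TiePoint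

open ContactCylinder

/-! ## §1 The point engine: stratum iff at the point + presentation of `J₃ᵗ` at `A_𝔪` ⇒ the body -/

/-- **(open″)≤3 AT A POINT-CENTRE POSITION — engine for `(iotaFlatT, jFlatT)`.**  `k₀` perfect, `A` of finite type over `k₀`, `𝔪` a
prime with `dim A_𝔪 = 3`.  Inputs: (i) the STRATUM IFF AT THE POINT — some `h₁ ∉ 𝔪` such that at
every prime `𝔮 ∌ h₁` of local dimension `≤ 3`, `𝔪 ≤ 𝔮 ↔ (F ∈ 𝔪_{A_𝔮}² ∧ ι₃ᵗ(A_𝔮) F = ι₃ᵗ(A_𝔪) F)`; (ii) a PRESENTATION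
`jFlatT (A_𝔪) (F/1) m = weightedMonomialIdeal xy W m` by a positively weighted system `xy` spanning `𝔪 A_𝔪` with independent
differentials.  Output: `JOpenBodyLE3 iotaFlatT jFlatT A 𝔪 F` with `U` = numerators of `xy` (on a basic open `(∀ i, U i ∈ 𝔮) ↔ 𝔪 ≤ 𝔮`;
the presentation is demanded only at `𝔮 = 𝔪`, by heights). [OURS · L1 W4.3 · (o52-B) engine] -/
theorem jOpenBodyLE3_of_pointStratumIff
    (k₀ : Type) [Field k₀] [PerfectField k₀]
    (A : Type) [CommRing A] [Algebra k₀ A] [Algebra.FiniteType k₀ A] (𝔪 : Ideal A) [𝔪.IsPrime] (F : A)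
    (hdim : ringKrullDim (Localization.AtPrime 𝔪) = (3 : ℕ)) {h₁ : A} (hh₁ : h₁ ∉ 𝔪)
    (hiff : ∀ (𝔮 : Ideal A) [𝔮.IsPrime], h₁ ∉ 𝔮 → ringKrullDim (Localization.AtPrime 𝔮) ≤ (3 : ℕ) →
      (𝔪 ≤ 𝔮 ↔
        (algebraMap A (Localization.AtPrime 𝔮) F ∈ maximalIdeal (Localization.AtPrime 𝔮) ^ 2 ∧
          iotaFlatT (Localization.AtPrime 𝔮) (algebraMap A (Localization.AtPrime 𝔮) F) =
            iotaFlatT (Localization.AtPrime 𝔪) (algebraMap A (Localization.AtPrime 𝔪) F))))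
    {N : ℕ} (xy : Fin N → Localization.AtPrime 𝔪) (W : Fin N → ℕ) (hW : ∀ i, 0 < W i)
    (hxy : ∀ i, xy i ∈ maximalIdeal (Localization.AtPrime 𝔪))
    (hspan : Ideal.span (Set.range xy) = maximalIdeal (Localization.AtPrime 𝔪))
    (hli : LinearIndependent (ResidueField (Localization.AtPrime 𝔪))
      (fun i => ((maximalIdeal (Localization.AtPrime 𝔪)).toCotangent ⟨xy i, hxy i⟩ :
        CotangentSpace (Localization.AtPrime 𝔪))))
    (hJ : ∀ m : ℕ, jFlatT (Localization.AtPrime 𝔪) (algebraMap A (Localization.AtPrime 𝔪) F) m =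
      weightedMonomialIdeal xy W m) :
    JOpenLE3.JOpenBodyLE3 iotaFlatT jFlatT A 𝔪 F := by
  classical
  haveI : IsNoetherianRing A := Algebra.FiniteType.isNoetherianRing k₀ A
  -- numerators of the system `xy`
  have hnum : ∀ i, ∃ (a : A) (s : 𝔪.primeCompl), algebraMap A (Localization.AtPrime 𝔪) a =
      algebraMap A (Localization.AtPrime 𝔪) (s : A) * xy i := fun i => by
    obtain ⟨⟨a, s⟩, has⟩ := IsLocalization.surj 𝔪.primeCompl (xy i)
    exact ⟨a, s, by rw [← has, mul_comm]⟩
  choose U s hUs using hnum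
  have hsu : ∀ i, IsUnit (algebraMap A (Localization.AtPrime 𝔪) (s i : A)) := fun i =>
    IsLocalization.map_units (Localization.AtPrime 𝔪) (s i)
  have hUm : ∀ i, algebraMap A (Localization.AtPrime 𝔪) (U i) ∈ maximalIdeal (Localization.AtPrime 𝔪) := fun i => by
    rw [hUs i]; exact Ideal.mul_mem_left _ _ (hxy i)
  have hUm𝔪 : ∀ i, U i ∈ 𝔪 := fun i =>
    (IsLocalization.AtPrime.to_map_mem_maximal_iff (Localization.AtPrime 𝔪) 𝔪 (U i)).mp (hUm i)
  -- same ideals: the span and the weighted monomial ideals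
  have hspanU : Ideal.span (Set.range fun i => algebraMap A (Localization.AtPrime 𝔪) (U i)) =
      maximalIdeal (Localization.AtPrime 𝔪) := by
    apply le_antisymm
    · rw [Ideal.span_le]
      rintro _ ⟨i, rfl⟩
      exact hUm i
    · rw [← hspan, Ideal.span_le]
      rintro _ ⟨i, rfl⟩
      rw [SetLike.mem_coe, ← Ideal.unit_mul_mem_iff_mem _ (hsu i), ← hUs i]
      exact Ideal.subset_span ⟨i, rfl⟩
  have hmapU : (Ideal.span (Set.range U)).map (algebraMap A (Localization.AtPrime 𝔪)) =
      maximalIdeal (Localization.AtPrime 𝔪) := by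
    rw [← hspanU, Ideal.map_span, ← Set.range_comp]
    rfl
  have hwmi : ∀ m, weightedMonomialIdeal (fun i => algebraMap A (Localization.AtPrime 𝔪) (U i)) W m =
      weightedMonomialIdeal xy W m := fun m => by
    have : (fun i => algebraMap A (Localization.AtPrime 𝔪) (U i)) =
        fun i => algebraMap A (Localization.AtPrime 𝔪) (s i : A) * xy i := funext hUs
    rw [this, GenericEquimultiplicity.weightedMonomialIdeal_unit_mul xy _ hsu W m]
  -- linear independence of the cotangent images of the numerators
  have hliU : LinearIndependent (ResidueField (Localization.AtPrime 𝔪))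
      (fun i => ((maximalIdeal (Localization.AtPrime 𝔪)).toCotangent
        ⟨algebraMap A (Localization.AtPrime 𝔪) (U i), hUm i⟩ : CotangentSpace (Localization.AtPrime 𝔪))) := by
    have hne : ∀ i, residue (Localization.AtPrime 𝔪) (algebraMap A (Localization.AtPrime 𝔪) (s i : A)) ≠ 0 := fun i => by
      rw [ne_eq, residue_eq_zero_iff]
      exact fun h => (mem_nonunits_iff.mp ((IsLocalRing.mem_maximalIdeal _).mp h)) (hsu i)
    have h := hli.units_smul fun i => Units.mk0 _ (hne i)
    convert h using 1
    funext i
    rw [Pi.smul_apply', Units.smul_def, Units.val_mk0, ← ResidueField.algebraMap_eq, algebraMap_smul, ← map_smul]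
    congr 1
    apply Subtype.ext
    change algebraMap A (Localization.AtPrime 𝔪) (U i) = _
    rw [Submodule.coe_smul, smul_eq_mul, hUs i]
  -- the bridge `(∀ i, U i ∈ 𝔮) ↔ 𝔪 ≤ 𝔮` on a basic open
  have hcomap : (maximalIdeal (Localization.AtPrime 𝔪)).comap (algebraMap A (Localization.AtPrime 𝔪)) = 𝔪 :=
    Localization.AtPrime.under_maximalIdeal
  obtain ⟨h₂, hh₂, hbridge⟩ := StratumIff.exists_forall_le_iff_comap_le 𝔪 (Ideal.span (Set.range U))
  have hUq : ∀ (𝔮 : Ideal A) [𝔮.IsPrime], h₂ ∉ 𝔮 → ((∀ i, U i ∈ 𝔮) ↔ 𝔪 ≤ 𝔮) := by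
    intro 𝔮 _ hh₂𝔮
    rw [← hcomap, ← hmapU, ← hbridge 𝔮 hh₂𝔮, Ideal.span_le, Set.range_subset_iff]
    rfl
  -- assemble the body
  refine ⟨h₁ * h₂, fun hmem => (Ideal.IsPrime.mem_or_mem inferInstance hmem).elim hh₁ hh₂, N, U, W, hW, ⟨hUm, hliU⟩,
    fun 𝔮 _ hh𝔮 hdim𝔮 => ?_⟩
  have hh₁𝔮 : h₁ ∉ 𝔮 := fun h' => hh𝔮 (Ideal.mul_mem_right _ _ h')
  have hh₂𝔮 : h₂ ∉ 𝔮 := fun h' => hh𝔮 (Ideal.mul_mem_left _ _ h')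
  refine ⟨(hUq 𝔮 hh₂𝔮).trans (hiff 𝔮 hh₁𝔮 hdim𝔮), fun hU𝔮 m => ?_⟩
  have heq : 𝔪 = 𝔮 := GenericEquimultiplicity.eq_of_le_of_ringKrullDim_le ((hUq 𝔮 hh₂𝔮).mp hU𝔮) hdim hdim𝔮
  subst heq
  rw [weightedMonomialIdeal_map, hwmi m, hJ m]

end TiePoint

/-! ## §2 The tie point body -/

namespace JOpenLE3

open ContactCylinder

/-- **THE TIE POINT BODY (P₀₁) of the (open″)≤3 regime assembly, from the presentation of `J₃ᵗ` at `ε = 0` point-centre positions.**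
Hypothesis (σ-pres)₃ (spelled out, as in `pointBodyLE3_zero_zero_of`; = the (pres) sub-block of
`CanonicalGameClauseLE 3 p iotaFlatT jFlatT` at the dimension-`3` positions whose top `ι₀`-stratum is the closed point and whose letter is
`ε = 0`; there `jFlatT = jSigmaPt`, so it is σ-ATTAINMENT + (J-can) + the flag bridge — a candidate obligation of the line, NOT asserted).
Conclusion: `JOpenLE3.PointBodyLE3 p 0 1` — at every model position `(A, 𝔪, F)` of dimension `3` with top `ι₀`-stratum the closed point
and `(ε, τ) = (0, 1)`, the body `JOpenBodyLE3 iotaFlatT jFlatT A 𝔪 F` (ι-side unconditional: res-L1-w43-stub-3's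
`CrossingPoint.exists_stratumIff_tie` over res-D-brk-1's `TieFinite.finite_tiePrimes_over`; assembly:
`TiePoint.jOpenBodyLE3_of_pointStratumIff`). [OURS · L1 W4.3 · (o52-Bτ)]
[cite: CossartPiltant2008, Prop. 4.2 (proof)] -/
theorem pointBodyLE3_zero_one_of (p : ℕ)
    (hσ : ∀ (k₀ : Type) [Field k₀] [CharP k₀ p] [PerfectField k₀]
      (S : Type) [CommRing S] [Algebra k₀ S] [Algebra.EssFiniteType k₀ S] [IsRegularLocalRing S] (f : S),
      ringKrullDim S = (3 : ℕ) → f ≠ 0 → f ∈ (maximalIdeal S) ^ 2 →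
      topStratumPrime iotaOrdEpsTau S f = maximalIdeal S → iotaEps S f = 0 →
      ∃ (n : ℕ) (u : Fin n → S) (w : Fin n → ℕ),
        Ideal.span (Set.range u) = maximalIdeal S ∧ (maximalIdeal S).spanFinrank = n ∧ (∀ i, 0 < w i) ∧
        ∀ m : ℕ, weightedMonomialIdeal u w m = jFlatT S f m) :
    PointBodyLE3 p 0 1 := by
  intro k₀ _ _ _ A _ _ _ 𝔪 _ F hreg hdim hF0 hF2 htop hε hτ
  haveI := hreg
  -- the presentation of `J₃ᵗ` at `S = A_𝔪` (hypothesis (σ-pres)₃)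
  obtain ⟨n, u, w, hspan, hn, hw, hJ⟩ := hσ k₀ (Localization.AtPrime 𝔪) (algebraMap A (Localization.AtPrime 𝔪) F)
    hdim hF0 hF2 htop hε
  have hu : ∀ i, u i ∈ maximalIdeal (Localization.AtPrime 𝔪) := fun i => hspan ▸ Ideal.subset_span ⟨i, rfl⟩
  -- the ι-side at the tie point (res-L1-w43-stub-3's `CrossingPoint.exists_stratumIff_tie`, p561178)
  obtain ⟨h₁, hh₁, hiff⟩ := CrossingPoint.exists_stratumIff_tie k₀ 𝔪 F hreg hdim hF0 hF2 hτ
  exact TiePoint.jOpenBodyLE3_of_pointStratumIff k₀ A 𝔪 F hdim hh₁ (fun 𝔮 _ h𝔮 hd => hiff 𝔮 h𝔮 hd) u w hw hu hspan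
    (IsolatedPoint.linearIndependent_toCotangent_of_span_eq u hspan hn hu) (fun m => (hJ m).symm)

end JOpenLE3

end Summit.ResolutionOfSingularities.ResolutionOfSingularities.Theorems

end
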